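import Summits.SmoothPoincare4.SmoothPoincare4.Theses.EntropyRung
import Summits.SmoothPoincare4.SmoothPoincare4.Theorems.SubcylindricalExistence.Negative.Window
import Summits.SmoothPoincare4.SmoothPoincare4.Theorems.EntropyRungSubcylindricalExistenceSphereChart
import Summits.SmoothPoincare4.SmoothPoincare4.Theorems.EntropyRungSubcylindricalExistenceSphereHeight
import Summits.SmoothPoincare4.SmoothPoincare4.Theorems.EntropyRungSubcylindricalExistenceConcaveRamp
import Summits.SmoothPoincare4.SmoothPoincare4.Theorems.EntropyRungSubcylindricalExistenceEuclideanClauseOfRound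
import Summits.SmoothPoincare4.SmoothPoincare4.Theorems.EntropyRungSubcylindricalExistenceSphereGreenRound
import Summits.SmoothPoincare4.SmoothPoincare4.Theorems.EntropyRungSubcylindricalExistenceSphereWarpedFactor
import Summits.SmoothPoincare4.SmoothPoincare4.Theorems.EntropyRungSubcylindricalExistenceSphereWarpedRealisation
import Summits.SmoothPoincare4.SmoothPoincare4.Theorems.EntropyRungSubcylindricalExistenceSphereGreenWarped
import Summits.SmoothPoincare4.SmoothPoincare4.Theorems.EntropyRungSubcylindricalExistenceSphereBlowupTransport
import Literature.Geometry.Riemannian.RoundSphereProofs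
import Literature.Geometry.Riemannian.AubinYamabeSphereEuclidean
import HarnessLib

/-!
# The `S⁴` witness of the transfer stub of line `green-blowup-conformal-entropy`
# (crux `EntropyRung.SubcylindricalExistence`, stmt-SmoothPoincare4-10871; lead c5)

The transfer stub Â_b `stub_schwarzschildBlowupExistence` (reshape R-c3, Schwarzschild gauge) asks every
closed smooth homotopy 4-sphere `M` for Green data `(g, p, G, a, b, r)`: `G` smooth and positive on
`M ∖ {p}`, `R_g G − 6 □_g G = 0` there, `G → +∞` at `p`; `g` EUCLIDEAN in the ATLAS chart `extChartAt p`
on the closed ball of radius `r` and `G = a/‖y − φp‖² + b` there; `R_g ≥ 0` vanishing only on that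
ball; and the blow-up clause at level `ν_cyl + δ` for Perelman's `𝒲` written with weight `G⁴` and
`G⁻²|∇w|²_g` for test functions vanishing near `p`. It is SPC4-hard given the rung
(`Negative/SchwarzschildBlowupExistence`), and had never been instantiated.

`helper_schwarzschildBlowupExistence_sphereFour` (registered helper of the crux) is Â_b's body at
`M = Metric.sphere (0 : EuclideanSpace ℝ (Fin 5)) 1` with `b = 0`, `a = 4`, `r = 2`: on Mathlib's
unit sphere take `g = W² g_S` with `W = θ(2/(1 + ⟪x, p⟫))`, `θ` the concave ramp with
`s₁ = 1 + 2²/4`, `s₂ = 3` (`helper_concaveRamp`), so that (`helper_sphereWarpedFactor`,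
`helper_sphereWarpedRealisation`, `helper_sphereChart`) `g` has a Levi-Civita connection,
`R_g = W⁻³(12 W − 6 □W) ≥ 0` vanishing exactly on the chart ball `‖y‖ ≤ 2` at `p`, where `g` is
Euclidean; the Green function is `G = (2/(1 − ⟪x, p⟫))/W` (`helper_sphereHeight`,
`helper_sphereGreenRound`, `helper_sphereGreenWarped`: conformal covariance), equal to `4/‖y‖²` on the
ball; and the blow-up `G² g` is flat `ℝ⁴` in the chart at `−p`, so the blow-up clause at level
`log 6 − 2` is the Euclidean clause (`helper_sphereBlowupTransport` ∘ `helper_euclideanClauseOfRound`,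
the latter from RoundBound by blowing the round sphere up); finally
`δ := (log 6 − 2) − ν_cyl > 0` (`Negative.nuCyl_lt_nuRound`). Pure composition of the nine landed
witness helpers (p134137, p134220, p134173, p134378, p134301, p134214, p134190, p134610, p135050).
-/

noncomputable section

-- the Theorems namespace repeats a component of the summit path (as in every sibling file)
set_option linter.dupNamespace false

open scoped Manifold ContDiff Topology ENNReal NNReal ContinuousMap RealInnerProductSpace
open Set Filter MeasureTheory
open Literature.Geometry.Lorentzian Literature.Geometry.Riemannian

namespace Summit.SmoothPoincare4.SmoothPoincare4.Theorems

/-- **The `S⁴` witness of the transfer stub Â_b** (`b = 0`, `a = 4`, `r = 2`; registered helper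
`helper_schwarzschildBlowupExistence_sphereFour` of crux stmt-SmoothPoincare4-10871): on Mathlib's unit sphere
`S⁴ ⊂ ℝ⁵` the metric `g = W² g_S`, `W = θ(2/(1 + ⟪x, p⟫))`, with Green function
`G = (2/(1 − ⟪x, p⟫))/W`, is Euclidean on the chart ball `‖y‖ ≤ 2` at `p` with `G = 4/‖y‖²` there,
has `R_g ≥ 0` vanishing only there, and its blow-up `G² g` is flat `ℝ⁴`, whose `𝒲`-clause holds at
level `log 6 − 2 = ν_cyl + δ`. Composition of the nine witness helpers. [folklore] -/
theorem helper_schwarzschildBlowupExistence_sphereFour :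
    ∃ g : PseudoRiemannianMetric (𝓡 4) ∞ (EuclideanSpace ℝ (Fin 4)) (TangentSpace (𝓡 4) :
      Metric.sphere (0 : EuclideanSpace ℝ (Fin 5)) 1 → Type _), ∃ _ : g.HasLeviCivita, ∃ hg :
      g.IsRiemannian, ∃ p : Metric.sphere (0 : EuclideanSpace ℝ (Fin 5)) 1, ∃ G : Metric.sphere (0 :
      EuclideanSpace ℝ (Fin 5)) 1 → ℝ, ∃ a b r : ℝ, (ContMDiffOn (𝓡 4) 𝓘(ℝ, ℝ) ∞ G {p}ᶜ ∧ (∀ x, x ≠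
      p → 0 < G x) ∧ (∀ x, x ≠ p → g.scalarCurvature x * G x - 6 * g.dalembertian G x = 0) ∧ Tendsto
      G (𝓝[≠] p) atTop) ∧ (∀ x, 0 ≤ g.scalarCurvature x) ∧ (∀ x, g.scalarCurvature x = 0 → x ∈
      (extChartAt (𝓡 4) p).source ∧ extChartAt (𝓡 4) p x ∈ Metric.closedBall (extChartAt (𝓡 4) p p)
      r) ∧ 0 < a ∧ 0 ≤ b ∧ 0 < r ∧ (Metric.closedBall (extChartAt (𝓡 4) p p) r ⊆ (extChartAt (𝓡 4)
      p).target ∧ ∀ y ∈ Metric.closedBall (extChartAt (𝓡 4) p p) r, ∀ X W : EuclideanSpace ℝ (Fin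
      4), g.val ((extChartAt (𝓡 4) p).symm y) (mfderiv 𝓘(ℝ, EuclideanSpace ℝ (Fin 4)) (𝓡 4)
      (extChartAt (𝓡 4) p).symm y X) (mfderiv 𝓘(ℝ, EuclideanSpace ℝ (Fin 4)) (𝓡 4) (extChartAt (𝓡 4)
      p).symm y W) = ⟪X, W⟫) ∧ (∀ y ∈ Metric.closedBall (extChartAt (𝓡 4) p p) r, y ≠ extChartAt (𝓡
      4) p p → G ((extChartAt (𝓡 4) p).symm y) = a / ‖y - extChartAt (𝓡 4) p p‖ ^ 2 + b) ∧ ∃ δ : ℝ,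
      0 < δ ∧ ∀ τ : ℝ, 0 < τ → ∀ w : Metric.sphere (0 : EuclideanSpace ℝ (Fin 5)) 1 → ℝ, ContMDiff
      (𝓡 4) 𝓘(ℝ, ℝ) ∞ w → w =ᶠ[𝓝 p] 0 → ∫ x, (4 * Real.pi * τ) ^ (-(4 : ℝ) / 2) * (w x) ^ 2 * (G x)
      ^ 4 ∂(riemannianMeasure (g.toContMDiffRiemannianMetric hg)) = 1 → Real.log 2 + Real.log
      Real.pi / 2 - 3 / 2 + δ ≤ ∫ x, (4 * τ * ((G x)⁻¹ ^ 2 * g.gradSq w x) - (w x) ^ 2 * Real.log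
      ((w x) ^ 2) - 4 * (w x) ^ 2) * ((4 * Real.pi * τ) ^ (-(4 : ℝ) / 2) * (G x) ^ 4)
      ∂(riemannianMeasure (g.toContMDiffRiemannianMetric hg)) := by
  haveI hfact : Fact (Module.finrank ℝ (EuclideanSpace ℝ (Fin 5)) = 4 + 1) := ⟨finrank_euclideanSpace_fin⟩
  haveI : (@roundMetric (EuclideanSpace ℝ (Fin 5)) _ _ 4 _).HasLeviCivita :=
    (@roundMetric (EuclideanSpace ℝ (Fin 5)) _ _ 4 _).hasLeviCivita
  obtain ⟨p⟩ : Nonempty (Metric.sphere (0 : EuclideanSpace ℝ (Fin 5)) 1) :=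
    (NormedSpace.sphere_nonempty.2 zero_le_one).to_subtype
  -- helper 1: the charts at `p` and at `-p`
  obtain ⟨hp0, htgt, -, hinner⟩ := helper_sphereChart p
  obtain ⟨-, -, hsrc', hinner'⟩ := helper_sphereChart (-p)
  have hsrcp : ∀ x : Metric.sphere (0 : EuclideanSpace ℝ (Fin 5)) 1, x ≠ p →
      x ∈ (extChartAt (𝓡 4) (-p)).source := fun x hx ↦ hsrc' x (by rwa [neg_neg])
  have hinnerp : ∀ z : EuclideanSpace ℝ (Fin 4),
      ⟪(((extChartAt (𝓡 4) (-p)).symm z : Metric.sphere (0 : EuclideanSpace ℝ (Fin 5)) 1) :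
        EuclideanSpace ℝ (Fin 5)), (p : EuclideanSpace ℝ (Fin 5))⟫ = -((4 - ‖z‖ ^ 2) / (4 + ‖z‖ ^ 2)) := by
    intro z
    have h := hinner' z
    rw [coe_neg_sphere, inner_neg_right] at h
    linarith
  -- helpers 2 and 5: the round Green functions at `p` and at `-p`
  have hGreenP := helper_sphereGreenRound helper_sphereHeight p
  obtain ⟨hGSs, hGSpos, hLGS, hGStend, -⟩ := hGreenP
  have hGreenN := helper_sphereGreenRound helper_sphereHeight (-p)
  have hfun : (fun x : Metric.sphere (0 : EuclideanSpace ℝ (Fin 5)) 1 ↦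
      (2 / (1 - ⟪(x : EuclideanSpace ℝ (Fin 5)), ((-p : Metric.sphere (0 : EuclideanSpace ℝ (Fin 5)) 1) :
        EuclideanSpace ℝ (Fin 5))⟫))) =
      fun x : Metric.sphere (0 : EuclideanSpace ℝ (Fin 5)) 1 ↦
        (2 / (1 + ⟪(x : EuclideanSpace ℝ (Fin 5)), (p : EuclideanSpace ℝ (Fin 5))⟫)) := by
    funext x
    rw [coe_neg_sphere, inner_neg_right, sub_neg_eq_add]
  rw [hfun] at hGreenN
  have hFfacts : ContMDiffOn (𝓡 4) 𝓘(ℝ, ℝ) ∞ (fun x : Metric.sphere (0 : EuclideanSpace ℝ (Fin 5)) 1 ↦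
        (2 / (1 + ⟪(x : EuclideanSpace ℝ (Fin 5)), (p : EuclideanSpace ℝ (Fin 5))⟫))) {-p}ᶜ ∧
      (∀ x : Metric.sphere (0 : EuclideanSpace ℝ (Fin 5)) 1, x ≠ -p →
        0 < (2 / (1 + ⟪(x : EuclideanSpace ℝ (Fin 5)), (p : EuclideanSpace ℝ (Fin 5))⟫))) ∧
      (∀ x : Metric.sphere (0 : EuclideanSpace ℝ (Fin 5)) 1, x ≠ -p →
        (@roundMetric (EuclideanSpace ℝ (Fin 5)) _ _ 4 _).scalarCurvature x *
            (2 / (1 + ⟪(x : EuclideanSpace ℝ (Fin 5)), (p : EuclideanSpace ℝ (Fin 5))⟫)) -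
          6 * (@roundMetric (EuclideanSpace ℝ (Fin 5)) _ _ 4 _).dalembertian
            (fun x : Metric.sphere (0 : EuclideanSpace ℝ (Fin 5)) 1 ↦
              (2 / (1 + ⟪(x : EuclideanSpace ℝ (Fin 5)), (p : EuclideanSpace ℝ (Fin 5))⟫))) x = 0) ∧
      Tendsto (fun x : Metric.sphere (0 : EuclideanSpace ℝ (Fin 5)) 1 ↦
        (2 / (1 + ⟪(x : EuclideanSpace ℝ (Fin 5)), (p : EuclideanSpace ℝ (Fin 5))⟫))) (𝓝[≠] (-p)) atTop ∧
      (∀ x : Metric.sphere (0 : EuclideanSpace ℝ (Fin 5)) 1, x ≠ -p →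
        (@roundMetric (EuclideanSpace ℝ (Fin 5)) _ _ 4 _).gradSq
            (fun x : Metric.sphere (0 : EuclideanSpace ℝ (Fin 5)) 1 ↦
              (2 / (1 + ⟪(x : EuclideanSpace ℝ (Fin 5)), (p : EuclideanSpace ℝ (Fin 5))⟫))) x =
          (2 / (1 + ⟪(x : EuclideanSpace ℝ (Fin 5)), (p : EuclideanSpace ℝ (Fin 5))⟫)) ^ 2 *
            ((2 / (1 + ⟪(x : EuclideanSpace ℝ (Fin 5)), (p : EuclideanSpace ℝ (Fin 5))⟫)) - 1)) := by
    obtain ⟨h1, h2, h3, h4, h5⟩ := hGreenN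
    refine ⟨h1, fun x hx ↦ ?_, fun x hx ↦ ?_, h4, fun x hx ↦ ?_⟩
    · simpa only [coe_neg_sphere, inner_neg_right, sub_neg_eq_add] using h2 x hx
    · simpa only [coe_neg_sphere, inner_neg_right, sub_neg_eq_add] using h3 x hx
    · simpa only [coe_neg_sphere, inner_neg_right, sub_neg_eq_add] using h5 x hx
  -- helper 3: the ramp, with `s₁ = 1 + 2²/4 = 2`, `s₂ = 3`
  obtain ⟨θ, hθs, hθid, hθc, hθ0, hθ1, hθlt, hθcc, hθpos⟩ :=
    helper_concaveRamp (1 + (2 : ℝ) ^ 2 / 4) 3 (by norm_num) (by norm_num)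
  -- helper 6: the warped factor
  obtain ⟨hWs, hWpos, hLW, hLW0, hWeq⟩ := helper_sphereWarpedFactor p hFfacts (1 + (2 : ℝ) ^ 2 / 4) 3
    (by norm_num) (by norm_num) θ hθs hθid hθc hθ0 hθ1 hθlt hθcc hθpos
  -- helper 7: the realisation `g = W² g_S`
  obtain ⟨g, hgLC, hg, hgval, -, hR0, hRzero, hball, hflat, hWball⟩ :=
    helper_sphereWarpedRealisation helper_sphereChart p 2 two_pos _ hWs hWpos hLW hLW0 hWeq
  -- helper 8: the Green function `G = G_S / W`
  obtain ⟨⟨hGs, hGpos, hLG, hGtend⟩, hGform⟩ := helper_sphereGreenWarped p g hg _ hWs hWpos hgval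
    ⟨hGSs, hGSpos, hLGS, hGStend⟩ 2 two_pos hp0 hinner hWball
  -- helpers 4 and 9: the blow-up clause at level `log 6 − 2`
  have hClause := helper_sphereBlowupTransport p g hg _ hWs hWpos hgval hinnerp hsrcp (Real.log 6 - 2)
    helper_euclideanClauseOfRound
  refine ⟨g, hgLC, hg, p, _, 4, 0, 2, ⟨hGs, hGpos, hLG, hGtend⟩, hR0, hRzero, by norm_num, le_rfl, two_pos,
    ⟨hball, hflat⟩, hGform, (Real.log 6 - 2) - (Real.log 2 + Real.log Real.pi / 2 - 3 / 2),
    sub_pos.2 Summit.SmoothPoincare4.Cruxes.SubcylindricalExistence.Negative.nuCyl_lt_nuRound,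
    fun τ hτ w hw hw0 hnorm ↦ ?_⟩
  have h := hClause τ hτ w hw hw0 hnorm
  linarith

end Summit.SmoothPoincare4.SmoothPoincare4.Theorems

end
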